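import Mathlib
import Literature.AlgebraicGeometry.Resolution.BlowupAlgebraFlatBaseChange
import Literature.AlgebraicGeometry.Resolution.BlowupChartTransition
import Summits.ResolutionOfSingularities.ResolutionOfSingularities.Theorems.FrobeniusLadderFRationalResolutionBlowupChartPoints
import Summits.ResolutionOfSingularities.ResolutionOfSingularities.Theorems.FrobeniusLadderFRationalResolutionCompletedBaseChangeFibreFlat

/-!
# Crux `FrobeniusLadder.FRationalResolution` (stmt-ResolutionOfSingularities-15317), line `redirect`,
# stub `stub_diagonalizableQuotientResolution` — THE TRANSPORT STEP (T) ON THE BLOW-UP CHARTS: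
# `T[I/a]` versus `Ê[IÊ/a]` for the completion `Ê = (T_𝔳)^` of a model `T` at a maximal ideal `𝔳`

Third file of the (T) series (`…CompletedBaseChangeFibre`, `…CompletedBaseChangeFibreFlat`). The affine blowup algebras
commute with flat base change — `B ⊗_A A[I/a] ≅ B[J/a]`, `J = IB` (tree
`Literature.….BlowupAlgebraFlatBaseChange.exists_baseChange_linearEquiv`, Stacks 0805) — so the fibre-and-completion
comparison of `…CompletedBaseChangeFibreFlat` can be read DIRECTLY on the chart rings `A[I/a] → B[J/a]` of the two
blowing ups `Bl_I(Spec A)` and `Bl_{J}(Spec B)` along `ψ = blowupAlgebraMap`: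
* `exists_ringEquiv_tensor_blowupAlgebra` — a ring isomorphism `Θ : A[I/a] ⊗_A B ≃+* B[J/a]` with `Θ(r ⊗ 1) = ψ r`,
  `Θ(1 ⊗ y) = y` (`B` flat, `J = IB`);
* ★★ `isRegularLocalRing_iff_blowupAlgebra` — for a prime `𝔑'` of `B[J/a]` over `V(𝔪 A[I/a])` (`B` flat with
  `A/𝔪 ≅ B/𝔪B`): **`A[I/a]_{ψ⁻¹𝔑'}` is regular iff `B[J/a]_{𝔑'}` is** (transport along `Θ`, tree
  `…BlowupChartPoints.isRegularLocalRing_localization_iff_of_ringEquiv`);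
* ★★ `existsUnique_isPrime_comap_eq_blowupAlgebra` — over every prime `𝔫 ⊇ 𝔪 A[I/a]` of `A[I/a]` lies EXACTLY ONE prime of
  `B[J/a]`;
* ★★ `finite_not_isRegularLocalRing_blowupAlgebra` — if `A[I/a]` has finitely many non-regular primes over `V(𝔪)`, so has
  `B[J/a]`;
* THE MODEL FORM (§3): `A = T` Noetherian, `𝔪 = 𝔳` maximal, `B = Ê = (T_𝔳)^`, `J = IÊ` — all hypotheses discharged by
  `…CompletedBaseChangeFibreFlat` §4: ★★ **`isRegularLocalRing_iff_model_chart`,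
  `existsUnique_isPrime_comap_eq_model_chart`, `finite_not_isRegularLocalRing_model_chart`**. With
  `…BlowupChartPoints.exists_chart_prime` (points of `Bl` ↔ primes of the chart rings, regularity of `𝒪_{Bl,p}` ↔ of the
  localization) these give, chart by chart: the points of `Bl_{IÊ}(Spec Ê)` over `V(𝔪̂)` correspond one-to-one to the
  points of `Bl_I(Spec T)` over `𝔳`, with the same regularity, and «finitely many singular points over `V(𝔪̂)`» is read
  off on the model `T` (e.g. the toric chart ring `κ[P]` of a twisted isolated point) — the point-level input of the
  two-step recipes (`…MaximalIdealTower`, `…IntrinsicRecipeFinite`).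
What is still not done of (T): the assembly over ALL charts of `Bl_{IÊ}(Spec Ê)` into the scheme-level hypotheses
`hfin`/`hloc` (bookkeeping with `exists_chart_prime` and the stalk isomorphisms), and the `Bl_{𝔪_z}`-regularity input,
which needs the completion isomorphism of the local rings (`…CompletedBaseChangeFibreFlat.exists_ringEquiv_adicCompletion`
transported along `Θ`).

Honest label: ring-level plumbing toward ONE leaf stub (no stub, crux or summit closed). No definitions, no named facts,
no sorry. [cite: StacksProject, Tag 0805; Tag 0804; Tag 0C4G] [cite: GortzWedhorn2020, Prop. 13.91 (2); (13.19) p. 415]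
[cite: Matsumura1987, Thm. 8.14; §19 p. 158]
-/

noncomputable section

-- single-problem summit: the doubled namespace component is forced
set_option linter.dupNamespace false

open IsLocalRing AlgebraicGeometry
open scoped TensorProduct
open Literature.AlgebraicGeometry.Resolution

namespace Summit.ResolutionOfSingularities.ResolutionOfSingularities.Theorems.FRationalResolution.CompletedBaseChangeFibreChart

variable {A B : Type} [CommRing A] [CommRing B] [Algebra A B] (I : Ideal A) (J : Ideal B) (a : A)
  (hIJ : I.map (algebraMap A B) ≤ J)

/-! ## §1 The chart rings: `A[I/a] ⊗_A B ≅ B[J/a]` as rings -/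

/-- **`Θ : A[I/a] ⊗_A B ≃+* B[J/a]`, `Θ(r ⊗ y) = ψ(r)·y`** for `B` flat over `A` and `J = IB` — the ring form of the tree's
`B`-linear `exists_baseChange_linearEquiv` (Stacks 0805). [cite: StacksProject, Tag 0805] [cite: GortzWedhorn2020, Prop. 13.91 (2)] -/
theorem exists_ringEquiv_tensor_blowupAlgebra [Module.Flat A B] (hJI : J ≤ I.map (algebraMap A B)) :
    ∃ Θ : blowupAlgebra I a ⊗[A] B ≃+* blowupAlgebra J (algebraMap A B a),
      (∀ r : blowupAlgebra I a, Θ (algebraMap (blowupAlgebra I a) (blowupAlgebra I a ⊗[A] B) r) =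
        blowupAlgebraMap (algebraMap A B) I J a hIJ r) ∧
      (∀ (r : blowupAlgebra I a) (y : B), Θ (r ⊗ₜ y) =
        blowupAlgebraMap (algebraMap A B) I J a hIJ r * algebraMap B (blowupAlgebra J (algebraMap A B a)) y) := by
  set ψ := blowupAlgebraMap (algebraMap A B) I J a hIJ with hψ
  -- `ψ` as an `A`-algebra homomorphism
  have hψA : ∀ x : A, ψ (algebraMap A (blowupAlgebra I a) x) =
      algebraMap A (blowupAlgebra J (algebraMap A B a)) x := by
    intro x
    rw [hψ, blowupAlgebraMap_algebraMap, ← IsScalarTower.algebraMap_apply]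
  let ψA : blowupAlgebra I a →ₐ[A] blowupAlgebra J (algebraMap A B a) :=
    { toRingHom := ψ, commutes' := hψA }
  let θ : blowupAlgebra I a ⊗[A] B →ₐ[A] blowupAlgebra J (algebraMap A B a) :=
    Algebra.TensorProduct.lift ψA (IsScalarTower.toAlgHom A B (blowupAlgebra J (algebraMap A B a)))
      (fun _ _ => Commute.all _ _)
  have hθ : ∀ (r : blowupAlgebra I a) (y : B),
      θ (r ⊗ₜ y) = ψ r * algebraMap B (blowupAlgebra J (algebraMap A B a)) y := by
    intro r y
    exact Algebra.TensorProduct.lift_tmul _ _ _ r y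
  obtain ⟨e, he⟩ := BlowupAlgebraFlatBaseChange.exists_baseChange_linearEquiv I J a hIJ hJI
  -- `θ = e ∘ comm` as functions
  have hfac : ∀ t : blowupAlgebra I a ⊗[A] B, θ t = e (TensorProduct.comm A (blowupAlgebra I a) B t) := by
    intro t
    induction t using TensorProduct.induction_on with
    | zero => rw [map_zero, map_zero, map_zero]
    | tmul r y => rw [hθ, TensorProduct.comm_tmul, he, Algebra.smul_def, mul_comm]
    | add t₁ t₂ h₁ h₂ => rw [map_add, h₁, h₂, map_add, map_add]
  have hbij : Function.Bijective θ := by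
    have : (θ : blowupAlgebra I a ⊗[A] B → blowupAlgebra J (algebraMap A B a)) =
        e ∘ TensorProduct.comm A (blowupAlgebra I a) B := funext hfac
    rw [this]
    exact e.bijective.comp (TensorProduct.comm A (blowupAlgebra I a) B).bijective
  refine ⟨RingEquiv.ofBijective θ hbij, fun r => ?_, fun r y => ?_⟩
  · rw [RingEquiv.ofBijective_apply, Algebra.TensorProduct.algebraMap_apply, Algebra.algebraMap_self_apply, hθ,
      map_one, mul_one]
  · rw [RingEquiv.ofBijective_apply, hθ]

/-! ## §2 Regularity, points and finiteness over `V(𝔪)`, read on the chart rings -/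

/-- ★★ **Regularity on the two charts agrees**: for `B` flat over `A` with `B = A + 𝔪B`, `J = IB`, and a prime `𝔑'` of
`B[J/a]` whose contraction `𝔫 = ψ⁻¹ 𝔑'` contains `𝔪 A[I/a]`: `A[I/a]_𝔫` is regular iff `B[J/a]_{𝔑'}` is regular.
[cite: Matsumura1987, Thm. 8.14; §19 p. 158] [cite: StacksProject, Tag 0805] -/
theorem isRegularLocalRing_iff_blowupAlgebra [Module.Flat A B] [IsNoetherianRing (blowupAlgebra I a)]
    [IsNoetherianRing (blowupAlgebra J (algebraMap A B a))] (hJI : J ≤ I.map (algebraMap A B)) (𝔪 : Ideal A)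
    (hres : ∀ b : B, ∃ x : A, b - algebraMap A B x ∈ 𝔪.map (algebraMap A B))
    (𝔑' : Ideal (blowupAlgebra J (algebraMap A B a))) [𝔑'.IsPrime]
    (h𝔑' : 𝔪.map (algebraMap A (blowupAlgebra I a)) ≤ 𝔑'.comap (blowupAlgebraMap (algebraMap A B) I J a hIJ)) :
    IsRegularLocalRing (Localization.AtPrime (𝔑'.comap (blowupAlgebraMap (algebraMap A B) I J a hIJ))) ↔
      IsRegularLocalRing (Localization.AtPrime 𝔑') := by
  obtain ⟨Θ, hΘ, -⟩ := exists_ringEquiv_tensor_blowupAlgebra I J a hIJ hJI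
  haveI : IsNoetherianRing (blowupAlgebra I a ⊗[A] B) := isNoetherianRing_of_ringEquiv _ Θ.symm
  haveI h𝔑p : (𝔑'.comap Θ.toRingHom).IsPrime := Ideal.comap_isPrime _ _
  have hmem : ∀ s, s ∈ 𝔑'.comap Θ.toRingHom ↔ Θ s ∈ 𝔑' := fun s => Iff.rfl
  have h𝔑 : (𝔑'.comap Θ.toRingHom).comap (algebraMap (blowupAlgebra I a) (blowupAlgebra I a ⊗[A] B)) =
      𝔑'.comap (blowupAlgebraMap (algebraMap A B) I J a hIJ) := by
    ext r
    rw [Ideal.mem_comap, hmem, hΘ, Ideal.mem_comap]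
  have h1 := CompletedBaseChangeFibreFlat.isRegularLocalRing_iff (B := B) 𝔪 hres
    (𝔑'.comap (blowupAlgebraMap (algebraMap A B) I J a hIJ)) h𝔑' (𝔑'.comap Θ.toRingHom) h𝔑
  exact h1.trans (BlowupChartPoints.isRegularLocalRing_localization_iff_of_ringEquiv Θ _ 𝔑' hmem)

/-- ★★ **Over every prime `𝔫 ⊇ 𝔪 A[I/a]` of `A[I/a]` lies exactly one prime of `B[J/a]`** (`B` flat, `B = A + 𝔪B`,
`𝔪B ∩ A ⊆ 𝔪`, `J = IB`). [cite: StacksProject, Tag 0805; Tag 0C4G] -/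
theorem existsUnique_isPrime_comap_eq_blowupAlgebra [Module.Flat A B] (hJI : J ≤ I.map (algebraMap A B))
    (𝔪 : Ideal A) (hres : ∀ b : B, ∃ x : A, b - algebraMap A B x ∈ 𝔪.map (algebraMap A B))
    (hinj : (𝔪.map (algebraMap A B)).comap (algebraMap A B) ≤ 𝔪)
    (𝔫 : Ideal (blowupAlgebra I a)) [𝔫.IsPrime] (h𝔫 : 𝔪.map (algebraMap A (blowupAlgebra I a)) ≤ 𝔫) :
    ∃! 𝔑' : Ideal (blowupAlgebra J (algebraMap A B a)),
      𝔑'.IsPrime ∧ 𝔑'.comap (blowupAlgebraMap (algebraMap A B) I J a hIJ) = 𝔫 := by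
  obtain ⟨Θ, hΘ, -⟩ := exists_ringEquiv_tensor_blowupAlgebra I J a hIJ hJI
  obtain ⟨𝔑, ⟨h𝔑p, h𝔑c⟩, huniq⟩ :=
    CompletedBaseChangeFibreFlat.existsUnique_isPrime_comap_eq (B := B) 𝔪 hres hinj 𝔫 h𝔫
  have hmem : ∀ (𝔑' : Ideal (blowupAlgebra J (algebraMap A B a))) s, s ∈ 𝔑'.comap Θ.toRingHom ↔ Θ s ∈ 𝔑' :=
    fun _ _ => Iff.rfl
  have hmem' : ∀ (𝔑₀ : Ideal (blowupAlgebra I a ⊗[A] B)) x, x ∈ 𝔑₀.comap Θ.symm.toRingHom ↔ Θ.symm x ∈ 𝔑₀ :=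
    fun _ _ => Iff.rfl
  have hcomapψ : ∀ 𝔑' : Ideal (blowupAlgebra J (algebraMap A B a)),
      (𝔑'.comap Θ.toRingHom).comap (algebraMap (blowupAlgebra I a) (blowupAlgebra I a ⊗[A] B)) =
        𝔑'.comap (blowupAlgebraMap (algebraMap A B) I J a hIJ) := by
    intro 𝔑'
    ext r
    rw [Ideal.mem_comap, hmem, hΘ, Ideal.mem_comap]
  haveI := h𝔑p
  refine ⟨𝔑.comap Θ.symm.toRingHom, ⟨Ideal.comap_isPrime _ _, ?_⟩, fun 𝔑' h𝔑' => ?_⟩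
  · have hback : (𝔑.comap Θ.symm.toRingHom).comap Θ.toRingHom = 𝔑 := by
      ext x
      rw [hmem, hmem', RingEquiv.symm_apply_apply]
    rw [← hcomapψ, hback, h𝔑c]
  · obtain ⟨h𝔑'p, h𝔑'c⟩ := h𝔑'
    haveI := h𝔑'p
    have hprime : (𝔑'.comap Θ.toRingHom).IsPrime := Ideal.comap_isPrime _ _
    have heq : 𝔑'.comap Θ.toRingHom = 𝔑 := huniq _ ⟨hprime, by rw [hcomapψ, h𝔑'c]⟩
    ext x
    rw [hmem', ← heq, hmem, RingEquiv.apply_symm_apply]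

/-- ★★ **Finiteness of the non-regular primes over `V(𝔪)` passes from `A[I/a]` to `B[J/a]`** (`B` flat, `A/𝔪 ≅ B/𝔪B`,
`J = IB`): `𝔑' ↦ ψ⁻¹𝔑'` is injective on the primes over `V(𝔪)` (uniqueness) and preserves non-regularity.
[cite: Matsumura1987, Thm. 8.14] [cite: StacksProject, Tag 0805] -/
theorem finite_not_isRegularLocalRing_blowupAlgebra [Module.Flat A B] [IsNoetherianRing (blowupAlgebra I a)]
    [IsNoetherianRing (blowupAlgebra J (algebraMap A B a))] (hJI : J ≤ I.map (algebraMap A B)) (𝔪 : Ideal A)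
    (hres : ∀ b : B, ∃ x : A, b - algebraMap A B x ∈ 𝔪.map (algebraMap A B))
    (hinj : (𝔪.map (algebraMap A B)).comap (algebraMap A B) ≤ 𝔪)
    (hfin : {𝔫 : PrimeSpectrum (blowupAlgebra I a) | 𝔪.map (algebraMap A (blowupAlgebra I a)) ≤ 𝔫.asIdeal ∧
      ¬ IsRegularLocalRing (Localization.AtPrime 𝔫.asIdeal)}.Finite) :
    {𝔑' : PrimeSpectrum (blowupAlgebra J (algebraMap A B a)) |
      𝔪.map (algebraMap A (blowupAlgebra I a)) ≤ 𝔑'.asIdeal.comap (blowupAlgebraMap (algebraMap A B) I J a hIJ) ∧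
      ¬ IsRegularLocalRing (Localization.AtPrime 𝔑'.asIdeal)}.Finite := by
  set ψ := blowupAlgebraMap (algebraMap A B) I J a hIJ with hψ
  refine Set.Finite.of_finite_image (f := PrimeSpectrum.comap ψ) (hfin.subset ?_) ?_
  · rintro _ ⟨𝔑', ⟨h𝔑'le, h𝔑'reg⟩, rfl⟩
    haveI := 𝔑'.isPrime
    refine ⟨h𝔑'le, fun hreg => h𝔑'reg ?_⟩
    exact (isRegularLocalRing_iff_blowupAlgebra I J a hIJ hJI 𝔪 hres 𝔑'.asIdeal h𝔑'le).mp hreg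
  · intro 𝔑₁ h₁ 𝔑₂ h₂ h12
    haveI := 𝔑₁.isPrime
    haveI := 𝔑₂.isPrime
    have h12' : 𝔑₁.asIdeal.comap ψ = 𝔑₂.asIdeal.comap ψ := by
      simpa only [PrimeSpectrum.ext_iff, PrimeSpectrum.comap_asIdeal] using h12
    haveI : (𝔑₁.asIdeal.comap ψ).IsPrime := inferInstance
    obtain ⟨𝔑, -, huniq⟩ := existsUnique_isPrime_comap_eq_blowupAlgebra I J a hIJ hJI 𝔪 hres hinj
      (𝔑₁.asIdeal.comap ψ) h₁.1
    have e₁ : 𝔑₁.asIdeal = 𝔑 := huniq _ ⟨𝔑₁.isPrime, rfl⟩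
    have e₂ : 𝔑₂.asIdeal = 𝔑 := huniq _ ⟨𝔑₂.isPrime, h12'.symm⟩
    ext1
    rw [e₁, e₂]

/-! ## §3 The model form: `T[I/a]` versus `Ê[IÊ/a]`, `Ê = (T_𝔳)^` -/

section Model

variable (T : Type) [CommRing T] [IsNoetherianRing T] (𝔳 : Ideal T) [h𝔳 : 𝔳.IsMaximal] (I₀ : Ideal T) (a₀ : T)

/-- ★★ **MODEL FORM, regularity on the charts**: for a prime `𝔑'` of the chart ring `Ê[I₀Ê/a₀]` of `Bl_{I₀Ê}(Spec Ê)`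
whose contraction `𝔫` to `T[I₀/a₀]` lies over `V(𝔳)`: `T[I₀/a₀]_𝔫` is regular iff `Ê[I₀Ê/a₀]_{𝔑'}` is.
[cite: Matsumura1987, Thm. 8.14; §19 p. 158] [cite: StacksProject, Tag 0805] -/
theorem isRegularLocalRing_iff_model_chart
    (𝔑' : Ideal (blowupAlgebra (I₀.map (algebraMap T (AdicCompletion (maximalIdeal (Localization.AtPrime 𝔳))
      (Localization.AtPrime 𝔳)))) (algebraMap T _ a₀))) [𝔑'.IsPrime]
    (h𝔑' : 𝔳.map (algebraMap T (blowupAlgebra I₀ a₀)) ≤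
      𝔑'.comap (blowupAlgebraMap (algebraMap T _) I₀ (I₀.map (algebraMap T _)) a₀ le_rfl)) :
    IsRegularLocalRing (Localization.AtPrime
        (𝔑'.comap (blowupAlgebraMap (algebraMap T _) I₀ (I₀.map (algebraMap T _)) a₀ le_rfl))) ↔
      IsRegularLocalRing (Localization.AtPrime 𝔑') := by
  haveI : IsNoetherianRing (Localization.AtPrime 𝔳) :=
    IsLocalization.isNoetherianRing 𝔳.primeCompl (Localization.AtPrime 𝔳) inferInstance
  haveI : IsNoetherianRing (AdicCompletion (maximalIdeal (Localization.AtPrime 𝔳)) (Localization.AtPrime 𝔳)) :=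
    isNoetherianRing_adicCompletion_maximalIdeal _
  haveI := isNoetherianRing_blowupAlgebra_of_isNoetherianRing I₀ a₀
  haveI := isNoetherianRing_blowupAlgebra_of_isNoetherianRing
    (I₀.map (algebraMap T (AdicCompletion (maximalIdeal (Localization.AtPrime 𝔳)) (Localization.AtPrime 𝔳))))
    (algebraMap T _ a₀)
  haveI := CompletedBaseChangeFibreFlat.flat_adicCompletion_atPrime T 𝔳
  exact isRegularLocalRing_iff_blowupAlgebra I₀ _ a₀ le_rfl le_rfl 𝔳
    (CompletedBaseChangeFibreFlat.forall_exists_sub_mem_adicCompletion_atPrime T 𝔳) 𝔑' h𝔑'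

/-- ★★ **MODEL FORM, points on the charts**: over every prime `𝔫 ⊇ 𝔳 T[I₀/a₀]` of `T[I₀/a₀]` lies EXACTLY ONE prime of
`Ê[I₀Ê/a₀]` (chartwise: the points of `Bl_{I₀Ê}(Spec Ê)` over `V(𝔪̂)` ↔ the points of `Bl_{I₀}(Spec T)` over `𝔳`).
[cite: StacksProject, Tag 0805; Tag 0C4G] -/
theorem existsUnique_isPrime_comap_eq_model_chart (𝔫 : Ideal (blowupAlgebra I₀ a₀)) [𝔫.IsPrime]
    (h𝔫 : 𝔳.map (algebraMap T (blowupAlgebra I₀ a₀)) ≤ 𝔫) :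
    ∃! 𝔑' : Ideal (blowupAlgebra (I₀.map (algebraMap T (AdicCompletion (maximalIdeal (Localization.AtPrime 𝔳))
      (Localization.AtPrime 𝔳)))) (algebraMap T _ a₀)),
      𝔑'.IsPrime ∧ 𝔑'.comap (blowupAlgebraMap (algebraMap T _) I₀ (I₀.map (algebraMap T _)) a₀ le_rfl) = 𝔫 := by
  haveI := CompletedBaseChangeFibreFlat.flat_adicCompletion_atPrime T 𝔳
  exact existsUnique_isPrime_comap_eq_blowupAlgebra I₀ _ a₀ le_rfl le_rfl 𝔳
    (CompletedBaseChangeFibreFlat.forall_exists_sub_mem_adicCompletion_atPrime T 𝔳)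
    (CompletedBaseChangeFibreFlat.comap_map_le_adicCompletion_atPrime T 𝔳) 𝔫 h𝔫

/-- ★★ **MODEL FORM, finiteness of the singular points over `V(𝔳)` on the charts**: if the chart ring `T[I₀/a₀]` of the
model has finitely many non-regular primes over `V(𝔳)`, so has the chart ring `Ê[I₀Ê/a₀]` of `Bl_{I₀Ê}(Spec Ê)` over
`V(𝔪̂)`. [cite: Matsumura1987, Thm. 8.14] [cite: StacksProject, Tag 0805] -/
theorem finite_not_isRegularLocalRing_model_chart
    (hfin : {𝔫 : PrimeSpectrum (blowupAlgebra I₀ a₀) | 𝔳.map (algebraMap T (blowupAlgebra I₀ a₀)) ≤ 𝔫.asIdeal ∧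
      ¬ IsRegularLocalRing (Localization.AtPrime 𝔫.asIdeal)}.Finite) :
    {𝔑' : PrimeSpectrum (blowupAlgebra (I₀.map (algebraMap T (AdicCompletion (maximalIdeal (Localization.AtPrime 𝔳))
        (Localization.AtPrime 𝔳)))) (algebraMap T _ a₀)) |
      𝔳.map (algebraMap T (blowupAlgebra I₀ a₀)) ≤
        𝔑'.asIdeal.comap (blowupAlgebraMap (algebraMap T _) I₀ (I₀.map (algebraMap T _)) a₀ le_rfl) ∧
      ¬ IsRegularLocalRing (Localization.AtPrime 𝔑'.asIdeal)}.Finite := by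
  haveI : IsNoetherianRing (Localization.AtPrime 𝔳) :=
    IsLocalization.isNoetherianRing 𝔳.primeCompl (Localization.AtPrime 𝔳) inferInstance
  haveI : IsNoetherianRing (AdicCompletion (maximalIdeal (Localization.AtPrime 𝔳)) (Localization.AtPrime 𝔳)) :=
    isNoetherianRing_adicCompletion_maximalIdeal _
  haveI := isNoetherianRing_blowupAlgebra_of_isNoetherianRing I₀ a₀
  haveI := isNoetherianRing_blowupAlgebra_of_isNoetherianRing
    (I₀.map (algebraMap T (AdicCompletion (maximalIdeal (Localization.AtPrime 𝔳)) (Localization.AtPrime 𝔳))))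
    (algebraMap T _ a₀)
  haveI := CompletedBaseChangeFibreFlat.flat_adicCompletion_atPrime T 𝔳
  exact finite_not_isRegularLocalRing_blowupAlgebra I₀ _ a₀ le_rfl le_rfl 𝔳
    (CompletedBaseChangeFibreFlat.forall_exists_sub_mem_adicCompletion_atPrime T 𝔳)
    (CompletedBaseChangeFibreFlat.comap_map_le_adicCompletion_atPrime T 𝔳) hfin

end Model

end Summit.ResolutionOfSingularities.ResolutionOfSingularities.Theorems.FRationalResolution.CompletedBaseChangeFibreChart

end
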